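import Mathlib
import Literature.NumberTheory.EllipticCurves.Rank1Residual.Typed.Basic
import Literature.NumberTheory.EllipticCurves.QuadraticTwist
import Summits.BirchSwinnertonDyer.BirchSwinnertonDyer.Theses.PrintCf2
import Summits.BirchSwinnertonDyer.BirchSwinnertonDyer.Theses.SylvesterTwoHeegnerIndex

/-!
# Sketch — crux idea `wild-twist-at-cm-prime` (seat bsd-idea-20 g2, critic idea-crit-15)

Host crux: `UpperOffV0HSYPlus` (stmt-BirchSwinnertonDyer-19804, route SylvesterTwoHeegnerIndex), whose
line of record is the cell's ROAD (k) (VARIANT K).  This file types the FIRST LEMMAS of the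
COMPANION mechanism asked for by director-bsd g12 KEY (c)(M4)(a): ROAD (k)'s coupled 𝒪-linear
Kolyvagin system at the inert prime 2 transposed to the Gross curves `A(q)`, `q ∈ {11,19,43,67,163}`,
with the quadratic partner (dead: coherent square, g1 BN1) replaced by the ORDER-`q^k` anticyclotomic
twist at the CM prime 𝔮 = (√-q) (k-th layer of the anticyclotomic ℤ_q-tower, conductor 𝔮^{2k}).  Nothing here proves a summit statement; every `def … : Prop` is a
statement, the three `theorem`s are elementary and closed (no `sorry`).

Typed conclusion fed BY NAME (not the host crux, which is the j = 0 leaf X12.CMAtTwo):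
`Summit.BirchSwinnertonDyer.BirchSwinnertonDyer.Theses.PrintCf2.InertOddHeegnerJOfFacts`
(stmt-BirchSwinnertonDyer-20672) ⊇ the per-curve currency
`Literature.NumberTheory.EllipticCurves.Rank1Residual.Typed.MissingUpperBoundAt W 2` on the good-twist
habitat below.
-/

set_option linter.dupNamespace false

namespace Summit.BirchSwinnertonDyer.BirchSwinnertonDyer.Cruxes.UpperOffV0HSYPlus.WildTwistAtCMPrime

open Literature.NumberTheory.EllipticCurves.Rank1Residual.Typed

/-- The five Gross primes `q ≡ 3 (mod 8)` with `h(-q) = 1`, `q > 3`. -/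
def grossPrimes : List ℕ := [11, 19, 43, 67, 163]

/-- (I1)_R, the arithmetic behind "ℤ₂[ζ_q] is an unramified self-conjugate coefficient ring":
`q ≡ 3 (mod 8)` and `2^((q-1)/2) ≡ -1 (mod q)` (Euler), so `-1 ∈ ⟨2⟩ ⊂ (ℤ/q)ˣ` and `ord_q 2 = 2f'`
with `f' ∣ (q-1)/2` odd; hence `ℤ₂[ζ_q] = ∏ W(𝔽_{4^{f'}})`, complex conjugation `ι` acts on EACH factor
as the involution of `W(𝔽_{4^{f'}})/W(𝔽_{2^{f'}})`, and `W(𝔽_{2^{f'}}) ⊗_{ℤ₂} ℤ₄ ≅ W(𝔽_{4^{f'}})`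
(f' odd).  First in-Lean check of the line. -/
theorem gross_two_pow_half :
    ∀ q ∈ grossPrimes, q % 8 = 3 ∧ ((q - 1) / 2) % 2 = 1 ∧ 2 ^ ((q - 1) / 2) % q = q - 1 := by
  decide

/-- LEMMA D_R (exact unramified SEMILINEAR descent; the coefficient-ring form of the cell's kernel
lemma `SylvesterTwoUnramifiedDescent.descent_bijective`, which is the case `R = ℤ[ω]`,
`ω - σ ω = √-3`): if `σ` is an involution of a commutative ring `R`, `ω : R` has `ω - σ ω` a UNIT,
and `T` is a `σ`-semilinear involution of an `R`-module `N`, then every `n : N` is UNIQUELY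
`x + ω • y` with `T x = x`, `T y = y`.  Used with `R = W(𝔽_{4^{f'}})`, `σ = ι`, `N = H¹(K, B'^χ[2^M])`,
`T = τ`: the descent `K = ℚ(√-q) → ℚ` costs NOTHING 2-adically (twist term 0), exactly as in ROAD (k). -/
def UnramifiedSemilinearDescent : Prop :=
  ∀ (R : Type) [CommRing R] (σ : R →+* R) (_hσ : ∀ r, σ (σ r) = r) (ω : R) (_hδ : IsUnit (ω - σ ω))
    (N : Type) [AddCommGroup N] [Module R N] (T : N →ₛₗ[σ] N) (_hT : ∀ n, T (T n) = n),
    ∀ n : N, ∃! xy : N × N, T xy.1 = xy.1 ∧ T xy.2 = xy.2 ∧ n = xy.1 + ω • xy.2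

/-- LEMMA D_R holds (elementary; existence `y = δ⁻¹ • (n - T n)`, `x = n - ω • y`, δ = ω - σ ω). -/
theorem unramifiedSemilinearDescent_holds : UnramifiedSemilinearDescent := by
  intro R _ σ hσ ω hδ N _ _ T hT n
  obtain ⟨u, hu⟩ := hδ
  have hσδ : σ (ω - σ ω) = -(ω - σ ω) := by rw [map_sub, hσ]; ring
  -- the candidate
  set y : N := (↑u⁻¹ : R) • (n - T n) with hy
  set x : N := n - ω • y with hx
  have hσu : σ (↑u⁻¹ : R) = -(↑u⁻¹ : R) := by
    have h1 : σ (↑u : R) * σ (↑u⁻¹ : R) = 1 := by rw [← map_mul, Units.mul_inv, map_one]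
    have h2 : σ (↑u : R) = -(↑u : R) := by rw [hu, hσδ]
    rw [h2] at h1
    have : (↑u⁻¹ : R) * (-(↑u : R) * σ (↑u⁻¹ : R)) = (↑u⁻¹ : R) * 1 := by rw [h1]
    rw [← mul_assoc, mul_neg, Units.inv_mul, mul_one] at this
    linear_combination -this
  have hTy : T y = y := by
    rw [hy, LinearMap.map_smulₛₗ, map_sub, hT, hσu, neg_smul, ← smul_neg, neg_sub]
  have hTx : T x = x := by
    rw [hx, map_sub, LinearMap.map_smulₛₗ, hTy]
    -- T n = n - δ • y
    have hδy : (ω - σ ω) • y = n - T n := by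
      rw [hy, smul_smul, ← hu, Units.mul_inv, one_smul]
    rw [sub_smul] at hδy
    -- from hδy: ω•y - σ ω • y = n - T n  ⇒  T n - σ ω • y = n - ω • y
    have : T n = n - ω • y + σ ω • y := by
      have := hδy; -- ω • y - σ ω • y = n - T n
      calc T n = n - (ω • y - σ ω • y) := by rw [this]; abel
        _ = n - ω • y + σ ω • y := by abel
    rw [this]; abel
  refine ⟨(x, y), ⟨hTx, hTy, show n = x + ω • y by rw [hx, sub_add_cancel]⟩, ?_⟩
  rintro ⟨x', y'⟩ ⟨hx', hy', hn'⟩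
  -- uniqueness: δ • (y' - y) = 0
  have key : (ω - σ ω) • y' = n - T n := by
    rw [hn', map_add, LinearMap.map_smulₛₗ, hx', hy', sub_smul]; abel
  have hyy : y' = y := by
    have := congrArg (fun z => (↑u⁻¹ : R) • z) key
    simp only [smul_smul, ← hu, Units.inv_mul, one_smul] at this
    rw [this, hy]
  have hxx : x' = x := by
    rw [hx, ← hyy]
    have := hn'  -- n = x' + ω • y'
    rw [this]; abel
  rw [hxx, hyy]

/-- A rational prime `ℓ` is a GOOD twisting prime for the Gross curve `A(q)`:
`4ℓ = x² + q y²` with `x, y` odd, i.e. `ℓ = N((x + y√-q)/2)` splits in `K = ℚ(√-q)` into principal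
primes whose generator is `≢ 1 (mod 2𝒪_K)`, i.e. `Frob_ℓ` has ORDER 3 on `A(q)[2] ≅ 𝔽₄`
(`K(A(q)[2]) = H₂`, the ring class field of conductor 2).  Consequences used by the line, for `ℓ ∣ d`:
`A(q)^{(d)}(ℚ_ℓ)[2] = 0`, `H¹(ℚ_ℓ, A(q)^{(d)}[2^M]) = 0`, Tamagawa `c_ℓ(A(q)^{(d)}) = 1`. -/
def GoodTwistPrime (q ℓ : ℕ) : Prop :=
  ∃ x y : ℕ, x % 2 = 1 ∧ y % 2 = 1 ∧ x * x + q * (y * y) = 4 * ℓ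

/-- The good-twist habitat of discriminants for `A(q)`: `d > 1` squarefree, `d ≡ 1 (mod 4)` (so the
twist keeps good supersingular reduction at the inert prime 2 and `w(A(q)^{(d)}) = w(A(q)) = -1`),
every prime factor good. Smallest member for `q = 11`: `d = 5` (`20 = 3² + 11·1²`). -/
def GoodTwist (q d : ℕ) : Prop :=
  1 < d ∧ Squarefree d ∧ d % 4 = 1 ∧ ∀ ℓ : ℕ, ℓ.Prime → ℓ ∣ d → GoodTwistPrime q ℓ

example : GoodTwistPrime 11 5 := ⟨3, 1, by norm_num⟩
example : GoodTwistPrime 11 3 := ⟨1, 1, by norm_num⟩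
example : GoodTwistPrime 19 5 := ⟨1, 1, by norm_num⟩
example : GoodTwistPrime 11 23 := ⟨9, 1, by norm_num⟩

/-- Minimal models of the five Gross curves `A(q)` (Cremona 121b1, 361a1, 1849a1, 4489a1, 26569a1). -/
def grossCurve : ℕ → WeierstrassCurve ℚ
  | 11 => ⟨0, -1, 1, -7, 10⟩
  | 19 => ⟨0, 0, 1, -38, 90⟩
  | 43 => ⟨0, 0, 1, -860, 9707⟩
  | 67 => ⟨0, 0, 1, -7370, 243528⟩
  | 163 => ⟨0, 0, 1, -2174420, 1234136692⟩
  | _ => ⟨0, -1, 1, -7, 10⟩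

/-- Sanity: discriminants are `-q³` (conductor `q²`, CM prime the only bad prime). -/
theorem grossCurve_Δ :
    (grossCurve 11).Δ = -11 ^ 3 ∧ (grossCurve 19).Δ = -19 ^ 3 ∧ (grossCurve 43).Δ = -43 ^ 3 ∧
      (grossCurve 67).Δ = -67 ^ 3 ∧ (grossCurve 163).Δ = -163 ^ 3 := by
  refine ⟨?_, ?_, ?_, ?_, ?_⟩ <;>
    norm_num [grossCurve, WeierstrassCurve.Δ, WeierstrassCurve.b₂, WeierstrassCurve.b₄,
      WeierstrassCurve.b₆, WeierstrassCurve.b₈]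

/-- C⁺(habitat form), the per-curve OUTPUT of the card's cruxes K1 (explicit 2-adic Gross–Zagier
bookkeeping), K2 (𝔮-stringency of the derivative classes), K3 (coupled structure theorem over
`R = ℤ₂[ζ_{q^k}]`), K4 (habitat: sign + non-vanishing) + the partner's equivariant BSD
(Burungale–Flach 2024 Thm 1.2, rank 0, ALL primes): the Euler-system half `ord₂ #Ш ≤ ord₂ #Ш_an` for every rank-one GOOD quadratic
twist of a Gross curve — in the tree's currency `MissingUpperBoundAt W 2`.  Strictly inside the
class of `PrintCf2.InertOddHeegnerJOfFacts` (stmt-20672: same five j-invariants, all rank-one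
minimal models), which it feeds; NOT the host crux. -/
def UpperBoundOnGoodGrossTwists : Prop :=
  ∀ q ∈ grossPrimes, ∀ d : ℕ, GoodTwist q d →
    ∀ (W : WeierstrassCurve ℚ) [W.IsElliptic] [W.IsGloballyMinimal],
      (∃ C : WeierstrassCurve.VariableChange ℚ, C • W = (grossCurve q).quadraticTwist (d : ℚ)) →
      W.analyticRank = 1 → MissingUpperBoundAt W 2

/-- The typed conclusion this companion feeds, BY NAME (item stmt-BirchSwinnertonDyer-20672). -/
abbrev CompanionTarget : Prop :=
  Summit.BirchSwinnertonDyer.BirchSwinnertonDyer.Theses.PrintCf2.InertOddHeegnerJOfFacts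

/-- The host crux, BY NAME, for the record: this idea does NOT conclude it (ROAD (k) itself does,
via VARIANT K); it transposes ROAD (k)'s lever to the companion class. -/
abbrev HostCrux : Prop :=
  Summit.BirchSwinnertonDyer.BirchSwinnertonDyer.Theses.SylvesterTwoHeegnerIndex.UpperOffV0HSYPlus

end Summit.BirchSwinnertonDyer.BirchSwinnertonDyer.Cruxes.UpperOffV0HSYPlus.WildTwistAtCMPrime
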